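import Mathlib
import Summits.QuantumFields.QCD.Theorems.QuarksAsStableActionUnquenchedChessboardBoundLinkGramBlocks
import Summits.QuantumFields.QCD.Theorems.QuarksAsStableActionUnquenchedChessboardBoundLinkGramCouplings
import Summits.QuantumFields.QCD.Theorems.QuarksAsStableActionUnquenchedChessboardBoundLinkGramField
import Summits.QuantumFields.QCD.Theorems.QuarksAsStableActionUnquenchedChessboardBoundLinkGramSlab
import HarnessLib

/-!
# Link Gram identity, part 7: the pathwise Gram identity of a symmetric slab
(crux stmt-QuantumFields-9735, line `Sketch`, lead's stub `linkGram`)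

Assembly of parts 2–6: in the temporal gauge, for the closed slab `F` of the slices `-p, …, p+1`,

  `det D^{AP}_F[z U] = (m+4)^R · Σ_{S,T} w(S,T) ρ(Q[W U])_{S,T} · conj ρ(Q[W (Θ U)])_{S,T}`

(`gram_identity_slab`; `W = linkField`, `Q = linkQ` the upper block, `w = linkWeight ∈ {0,1}`),
together with the companion identities for the upper half `A` and for `∅`:
`det D^{AP}_A[zU] = (m+4)^{R+n} det Q_A[W U]` (`det_upper_slab_splice`),
`det D^{AP}_∅[V] = (m+4)^{#indices}` (`det_empty_bonds`), `#indices = 2n + R` (`card_indices_eq`),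
and `ρ(Q)_{∅,∅} = det Q` (`rho_empty`). All statements are proved.
-/

noncomputable section

open Matrix Complex Finset
open Literature.MathematicalPhysics.QuantumFieldTheory Literature.MathematicalPhysics.QuantumLattice
open Literature.Probability.LatticeModels (TorusSite)
open Summit.QuantumFields.QCD.Theorems.QuarksAsStableAction
open scoped ComplexConjugate BigOperators

namespace Summit.QuantumFields.QCD.Theorems.UnquenchedChessboardBoundLine

variable {L N : ℕ} [NeZero L] [Fact (1 < L)]

/-! ## The signs and weights -/

/-- The lower-chirality coupling diagonal `d₁ = -𝟙[t = 1, α ≥ 2]`. -/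
def linkD₁ (L N p : ℕ) [NeZero L] (i : Fin (linkUpCard L N p)) : ℂ :=
  if ((linkUpEnum L N p i).1.1 0).val = 1 ∧ 2 ≤ ((linkUpEnum L N p i).1.2.2 : ℕ) then -1 else 0

/-- The upper-chirality coupling diagonal `d₂ = -𝟙[t = 1, α < 2]`. -/
def linkD₂ (L N p : ℕ) [NeZero L] (i : Fin (linkUpCard L N p)) : ℂ :=
  if ((linkUpEnum L N p i).1.1 0).val = 1 ∧ ((linkUpEnum L N p i).1.2.2 : ℕ) < 2 then -1 else 0

/-- The chirality sign `ε = γ'₀ αα = ±1`. -/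
def linkEps (L N p : ℕ) [NeZero L] (i : Fin (linkUpCard L N p)) : ℂ :=
  chiralGamma 0 (linkUpEnum L N p i).1.2.2 (linkUpEnum L N p i).1.2.2

/-- **The Gram weights** `w(S,T) = 𝟙[|S| = |T|, d₁ ≠ 0 on S, d₂ ≠ 0 on T] ∈ {0, 1}`. -/
def linkWeight (L N p : ℕ) [NeZero L] (S T : Finset (Fin (linkUpCard L N p))) : ℂ :=
  if S.card = T.card ∧ (∀ i ∈ S, linkD₁ L N p i ≠ 0) ∧ (∀ i ∈ T, linkD₂ L N p i ≠ 0) then 1 else 0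

omit [Fact (1 < L)] in
/-- The weights are `0` or `1`. -/
theorem linkWeight_eq_zero_or_one (p : ℕ) (S T : Finset (Fin (linkUpCard L N p))) :
    linkWeight L N p S T = 0 ∨ linkWeight L N p S T = 1 := by
  unfold linkWeight
  split_ifs
  · exact Or.inr rfl
  · exact Or.inl rfl

omit [Fact (1 < L)] in
/-- `ε = ±1`. -/
theorem linkEps_sign (p : ℕ) (i : Fin (linkUpCard L N p)) : linkEps L N p i = 1 ∨ linkEps L N p i = -1 := by
  unfold linkEps
  generalize (linkUpEnum L N p i).1.2.2 = α
  fin_cases α <;> simp [chiralGamma]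

omit [Fact (1 < L)] in
/-- `d₁ ∈ {0} ∪ {-1 with ε = -1}`. -/
theorem linkD₁_cases (p : ℕ) (i : Fin (linkUpCard L N p)) :
    linkD₁ L N p i = 0 ∨ (linkD₁ L N p i = -1 ∧ linkEps L N p i = -1) := by
  unfold linkD₁ linkEps
  generalize (linkUpEnum L N p i).1.2.2 = α
  by_cases h : ((linkUpEnum L N p i).1.1 0).val = 1 ∧ 2 ≤ (α : ℕ)
  · refine Or.inr ⟨if_pos h, ?_⟩
    obtain ⟨-, h2⟩ := h
    fin_cases α <;> simp [chiralGamma] at h2 ⊢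
  · exact Or.inl (if_neg h)

omit [Fact (1 < L)] in
/-- `d₂ ∈ {0} ∪ {-1 with ε = 1}`. -/
theorem linkD₂_cases (p : ℕ) (i : Fin (linkUpCard L N p)) :
    linkD₂ L N p i = 0 ∨ (linkD₂ L N p i = -1 ∧ linkEps L N p i = 1) := by
  unfold linkD₂ linkEps
  generalize (linkUpEnum L N p i).1.2.2 = α
  by_cases h : ((linkUpEnum L N p i).1.1 0).val = 1 ∧ (α : ℕ) < 2
  · refine Or.inr ⟨if_pos h, ?_⟩
    obtain ⟨-, h2⟩ := h
    fin_cases α <;> simp [chiralGamma] at h2 ⊢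
  · exact Or.inl (if_neg h)

/-! ## The pathwise Gram identity of the symmetric slab -/

omit [NeZero L] [Fact (1 < L)] in
/-- `2p + 1 ≤ L/2` and `4 ≤ L` give `2p + 2 < L`. -/
theorem two_mul_add_two_lt (h4 : 4 ≤ L) {p : ℕ} (hp : 2 * p + 1 ≤ L / 2) : 2 * p + 2 < L := by omega

/-- **The pathwise Gram identity** (see the module docstring). -/
theorem gram_identity_slab (h4 : 4 ≤ L) (hL : Even L) (p : ℕ) (hp : 2 * p + 1 ≤ L / 2)
    (U : GaugeConfig 4 L (Matrix.specialUnitaryGroup (Fin N) ℂ)) (m : ℝ) :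
    (bondWilsonDiracAP (slabBonds (-(p : ZMod L)) (2 * p + 1))
        (LatticeRP.splice WilsonRP.crossEdges (U, 1)) m).det =
      ((m + 4 * 1 : ℝ) : ℂ) ^
          Fintype.card {i : TorusSite 4 L × Fin N × Fin 4 //
            ¬ (i.1 ∈ linkUpSites p ∨ Site.timeReflect i.1 ∈ linkUpSites p)} *
        ∑ S : Finset (Fin (linkUpCard L N p)), ∑ T : Finset (Fin (linkUpCard L N p)),
          linkWeight L N p S T *
            (rho (linkQ (unitaryFundamentalRep (Fin N) ℂ) p (slabBonds (-(p : ZMod L)) (2 * p + 1))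
                (linkField U) m) S T *
              conj (rho (linkQ (unitaryFundamentalRep (Fin N) ℂ) p
                (slabBonds (-(p : ZMod L)) (2 * p + 1)) (linkField U.timeReflect) m) S T)) := by
  have hpL := two_mul_add_two_lt h4 hp
  set F := slabBonds (-(p : ZMod L)) (2 * p + 1) with hF
  have hJ₁ : linkJ₁ (unitaryFundamentalRep (Fin N) ℂ) p F (linkField U) m = diagonal (linkD₁ L N p) := by
    rw [linkJ₁_eq_diagonal _ p hpL F (fun x hx => slab_lowerCross_mem hpL x hx) (linkField U)
      (fun x hx => linkField_apply_lowerCross h4 U x hx) m]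
    rfl
  have hJ₂ : linkJ₂ (unitaryFundamentalRep (Fin N) ℂ) p F (linkField U) m = diagonal (linkD₂ L N p) := by
    rw [linkJ₂_eq_diagonal _ p hpL F (fun x hx => slab_lowerCross_mem hpL x hx) (linkField U)
      (fun x hx => linkField_apply_lowerCross h4 U x hx) m]
    rfl
  have hP : linkP (unitaryFundamentalRep (Fin N) ℂ) p F (linkField U) m =
      diagonal (linkEps L N p) *
        (linkQ (unitaryFundamentalRep (Fin N) ℂ) p F (linkField U.timeReflect) m)ᴴ *
          diagonal (linkEps L N p) := by
    rw [linkP_eq_mirror _ unitaryFundamentalRep_mem_unitaryGroup p F (linkField U) m,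
      timeReflect_linkField hL, image_edgeReflect_slab hpL]
    rfl
  rw [det_bondWilsonDiracAP_splice, det_bondWilsonDiracG_eq_linkBlocks _ p hpL F
    (slab_bonds_mem_up_or_lo hpL), hJ₁, hJ₂, hP, det_fromBlocks_mirror_gram _ _ (linkEps L N p)
    (linkD₁ L N p) (linkD₂ L N p) (linkEps_sign p) (linkD₁_cases p) (linkD₂_cases p), mul_comm]
  rfl

/-! ## The upper half and the empty bond set -/

/-- **Determinant of the upper half** `A = slabBonds 1 p` (all bonds between upper sites): the
lower block is bare and the couplings vanish, `det D'_A[W] = (m+4)^n · det Q_A[W] · (m+4)^R`. -/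
theorem det_upper_slab (h4 : 4 ≤ L) (p : ℕ) (hp : 2 * p + 1 ≤ L / 2)
    (W : GaugeConfig 4 L (Matrix.unitaryGroup (Fin N) ℂ)) (m : ℝ) :
    (bondWilsonDiracG (unitaryFundamentalRep (Fin N) ℂ) chiralGamma (slabBonds (1 : ZMod L) p) W m 1).det =
      ((m + 4 * 1 : ℝ) : ℂ) ^ linkUpCard L N p *
        (linkQ (unitaryFundamentalRep (Fin N) ℂ) p (slabBonds (1 : ZMod L) p) W m).det *
        ((m + 4 * 1 : ℝ) : ℂ) ^
          Fintype.card {i : TorusSite 4 L × Fin N × Fin 4 //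
            ¬ (i.1 ∈ linkUpSites p ∨ Site.timeReflect i.1 ∈ linkUpSites p)} := by
  have hpL := two_mul_add_two_lt h4 hp
  have hA := upper_slab_bonds_mem_up (L := L) hpL
  have hT : ∀ b ∈ slabBonds (1 : ZMod L) p, b.1 ∈ linkUpSites p ∧ b.1.shift b.2 ∈ linkUpSites p := hA
  have hentry := fun a b h => bondWilsonDiracG_apply_of_not_mem (unitaryFundamentalRep (Fin N) ℂ)
    chiralGamma (slabBonds (1 : ZMod L) p) (fun x => x ∈ linkUpSites p) hT W m 1 a b h
  have hlo : ∀ i : Fin (linkUpCard L N p), (linkMirror (linkUpEnum L N p i).1).1 ∉ linkUpSites p :=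
    fun i => timeReflect_not_mem_of_mem_linkUpSites hpL (linkUpEnum L N p i).2
  rw [det_bondWilsonDiracG_eq_linkBlocks _ p hpL (slabBonds (1 : ZMod L) p)
    (fun b hb => ⟨Or.inl (hA b hb).1, Or.inl (hA b hb).2⟩)]
  have hP : linkP (unitaryFundamentalRep (Fin N) ℂ) p (slabBonds (1 : ZMod L) p) W m =
      ((m + 4 * 1 : ℝ) : ℂ) • (1 : Matrix _ _ ℂ) := by
    ext i j
    simp only [linkP, Matrix.of_apply, Matrix.smul_apply, Matrix.one_apply, smul_eq_mul]
    rw [hentry _ _ (Or.inl (hlo i))]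
    by_cases hij : i = j
    · subst hij; simp
    · rw [if_neg, if_neg hij, mul_zero]
      intro h
      apply hij
      apply (linkUpEnum L N p).injective
      apply Subtype.ext
      simpa using congrArg linkMirror h
  have hJ₁ : linkJ₁ (unitaryFundamentalRep (Fin N) ℂ) p (slabBonds (1 : ZMod L) p) W m = 0 := by
    ext i j
    simp only [linkJ₁, Matrix.of_apply, Matrix.zero_apply]
    rw [hentry _ _ (Or.inl (hlo i)), if_neg]
    intro h
    exact hlo i (by rw [h]; exact (linkUpEnum L N p j).2)
  have hJ₂ : linkJ₂ (unitaryFundamentalRep (Fin N) ℂ) p (slabBonds (1 : ZMod L) p) W m = 0 := by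
    ext i j
    simp only [linkJ₂, Matrix.of_apply, Matrix.zero_apply]
    rw [hentry _ _ (Or.inr (hlo j)), if_neg]
    intro h
    exact hlo j (by rw [← h]; exact (linkUpEnum L N p i).2)
  rw [hP, hJ₁, hJ₂, Matrix.det_fromBlocks_zero₂₁, det_smul, det_one, mul_one, Fintype.card_fin]

omit [Fact (1 < L)] in
/-- **Determinant with no bonds**: `det D'_∅[W] = (m + 4r)^{#indices}`. -/
theorem det_empty_bonds (γ : Fin 4 → Matrix (Fin 4) (Fin 4) ℂ) (W : GaugeConfig 4 L (Matrix.unitaryGroup (Fin N) ℂ))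
    (m r : ℝ) :
    (bondWilsonDiracG (unitaryFundamentalRep (Fin N) ℂ) γ ∅ W m r).det =
      ((m + 4 * r : ℝ) : ℂ) ^ Fintype.card (TorusSite 4 L × Fin N × Fin 4) := by
  have h : bondWilsonDiracG (unitaryFundamentalRep (Fin N) ℂ) γ ∅ W m r =
      ((m + 4 * r : ℝ) : ℂ) • (1 : Matrix _ _ ℂ) := by
    ext a b
    rw [bondWilsonDiracG_apply_of_not_mem (unitaryFundamentalRep (Fin N) ℂ) γ ∅ (fun _ => False)
      (fun b hb => absurd hb (Finset.notMem_empty b)) W m r a b (Or.inl not_false),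
      Matrix.smul_apply, Matrix.one_apply, smul_eq_mul]
    split_ifs <;> simp
  rw [h, det_smul, det_one, mul_one]

/-- **Index count**: `#indices = n + n + R` (lower, upper, rest). -/
theorem card_indices_eq (h4 : 4 ≤ L) (p : ℕ) (hp : 2 * p + 1 ≤ L / 2) :
    Fintype.card (TorusSite 4 L × Fin N × Fin 4) =
      linkUpCard L N p + linkUpCard L N p +
        Fintype.card {i : TorusSite 4 L × Fin N × Fin 4 //
          ¬ (i.1 ∈ linkUpSites p ∨ Site.timeReflect i.1 ∈ linkUpSites p)} := by
  rw [← Fintype.card_congr (linkSortEquiv (N := N) p (two_mul_add_two_lt h4 hp)), Fintype.card_sum,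
    Fintype.card_sum, Fintype.card_fin]

omit [NeZero L] [Fact (1 < L)] in
/-- `ρ(A)_{∅,∅} = det A`. -/
theorem rho_empty {n : ℕ} (A : Matrix (Fin n) (Fin n) ℂ) : rho A ∅ ∅ = A.det := by
  have h : ∀ hc : (∅ : Finset (Fin n)).card = (∅ : Finset (Fin n)).card, rowRep A ∅ ∅ hc = A := by
    intro hc
    ext r c
    simp [rowRep]
  unfold rho
  rw [dif_pos rfl, h]

omit [Fact (1 < L)] in
/-- The weight of the empty pair is `1`. -/
theorem linkWeight_empty (p : ℕ) : linkWeight L N p ∅ ∅ = 1 := by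
  unfold linkWeight
  rw [if_pos ⟨rfl, fun i hi => absurd hi (Finset.notMem_empty i),
    fun i hi => absurd hi (Finset.notMem_empty i)⟩]

end Summit.QuantumFields.QCD.Theorems.UnquenchedChessboardBoundLine

end
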